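import Literature.Probability.Percolation.MarkedLoopBoundaryLawModule
import Mathlib.LinearAlgebra.Matrix.NonsingularInverse
import HarnessLib

/-!
# Boundary span from a square CENSUS CERTIFICATE: as many lawpoints as link patterns with an invertible count matrix («BSPAN-FROM-DETERMINANT»)

Topic `Literature/Probability/Percolation`; generic-`k` layer of the marked-loop (Khristoforov–Smirnov) lineage; a rider on `MarkedLoopBoundaryLawModule.lean`
(`lawLP z : LinkPattern (k+1) →₀ ℂ`, the home-arc boundary law of a lawpoint; ★ `bNonvanish_last_iff_span_lawLP` — `BNonvanish` on the home arc iff the home-arc laws of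
ALL lawpoints span the planar module) and `MarkedLoopBoundarySpan.lean` (`BSpan`, `BNonvanish`, `bSpan_iff_bNonvanish`, arc independence `bNonvanish_iff`).

WHY. The lane holds nine CRITERIA for `BSpan k` (#632, #649, #690, #732, #744, #887, #1067, «BSPAN-NESTED-FINITE», the induction schemes) and no instance. The shortest road to
an instance at a FIXED `k` is a census certificate: exhibit one lawpoint `z_Q` per link pattern `Q` of `k+1` sites and check that the square matrix of boundary pattern counts
`N^{z_Q}(Q′)` is invertible — then the laws of these `C_{(k+1)/2}` lawpoints alone span the module, hence `BSpan k a ∧ BNonvanish k a` on every arc. The lane's exact numerics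
(HOME `FINDING-BSPAN-ROUTE-DECISION.md` §4(c)): at `k = 5` five lawpoints on the `4 × 2` block suffice (rank 5 of 168), at `k = 7` fourteen on the `5 × 2` block (rank 14 of 360);
the counts themselves are kernel censuses of `2^8` resp. `2^10` configurations per lawpoint in the style of `MarkedLoopRhombusCensus*` — not in this file. This file is the
assembly: certificate in, `BSpan` out.

* ★ `span_eq_top_of_isUnit_det_apply` — vectors `v i : ι →₀ K` indexed by `ι` itself whose coordinate matrix `(v i) j` is invertible span `ι →₀ K` (rows of an invertible
  matrix are independent, `Matrix.linearIndependent_rows_iff_isUnit`; as many independent vectors as the dimension span, `finrank_span_eq_card` + `Module.finrank_finsupp_self`);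
* ★★★ `bNonvanish_of_isUnit_det_lawLP` / `bSpan_of_isUnit_det_lawLP'` — **THE CERTIFICATE CRITERION**: a family of home-arc lawpoints `z : LinkPattern (2m+2) → Σ D, ArcPoint D`
  whose count matrix `Q ↦ Q′ ↦ lawLP (z Q) Q′` has a unit determinant gives `BNonvanish (2m+1)` on the home arc and `BSpan ∧ BNonvanish` on every arc (`k = 2m+3 ≥ 3`);
* ★ `bNonvanish_of_det_lawLP_ne_zero` — the same with `det ≠ 0` (over `ℂ` a non-zero determinant is a unit).

## References
* M. Khristoforov, S. Smirnov, *Percolation and O(1) loop model*, arXiv:2111.15612 (2021), §1.2 (arXiv v1 p. 2: the law of the link pattern), §2 eq. (4) and Remark 6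
  (p. 5: boundary values on the arcs).
* P. A. Pearce, V. Rittenberg, J. de Gier, B. Nienhuis, *Temperley–Lieb stochastic processes*, J. Phys. A 35 (2002) L661–L668, §2 (the link-pattern module).
* B. Bollobás, O. Riordan, *Percolation*, CUP (2006), Ch. 7 §7.2.2 (pp. 191–195: marked discrete domains and their arcs).

## Mathlib / tree
Tree: `MarkedLoopBoundaryLawModule` (`lawLP`, `bNonvanish_last_iff_span_lawLP`), `MarkedLoopBoundarySpan` (`ArcPoint`, `BSpan`, `BNonvanish`, `bSpan_iff_bNonvanish`,
`bNonvanish_iff`). Mathlib: `Matrix.linearIndependent_rows_iff_isUnit`, `Matrix.isUnit_iff_isUnit_det`, `LinearIndependent.of_comp`, `Finsupp.linearEquivFunOnFinite`,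
`finrank_span_eq_card`, `Module.finrank_finsupp_self`, `Submodule.eq_top_of_finrank_eq`, `isUnit_iff_ne_zero`.
-/

open Finset

namespace Literature.Probability.Percolation.MarkedLoops

/-! ### Linear algebra: an invertible coordinate matrix spans -/

section LinearAlgebra

variable {K : Type*} [Field K] {ι : Type*} [Fintype ι] [DecidableEq ι]

/-- ★ **vectors indexed by the coordinate type whose coordinate matrix is invertible span the coordinate module**: for `v : ι → (ι →₀ K)` with
`IsUnit (Matrix.of fun i j => v i j)`, `span (range v) = ⊤`. [cite: PearceRittenbergDeGierNienhuis2002, §2 (the link-pattern module as a coordinate space); lane plumbing] -/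
theorem span_eq_top_of_isUnit_det_apply (v : ι → (ι →₀ K)) (hv : IsUnit (Matrix.of fun i j => v i j).det) :
    Submodule.span K (Set.range v) = ⊤ := by
  set A : Matrix ι ι K := Matrix.of fun i j => v i j with hA
  have hunit : IsUnit A := (Matrix.isUnit_iff_isUnit_det A).2 hv
  have hrows : LinearIndependent K A.row := Matrix.linearIndependent_rows_iff_isUnit.2 hunit
  -- the rows are the coordinate functions of the vectors: `A.row = e ∘ v` for the coordinate equivalence `e`
  let e : (ι →₀ K) →ₗ[K] (ι → K) := (Finsupp.linearEquivFunOnFinite K K ι).toLinearMap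
  have hcomp : A.row = e ∘ v := by
    funext i j
    rfl
  have hli : LinearIndependent K v := by
    rw [hcomp] at hrows
    exact LinearIndependent.of_comp e hrows
  -- as many independent vectors as the dimension
  refine Submodule.eq_top_of_finrank_eq ?_
  rw [finrank_span_eq_card hli, Module.finrank_finsupp_self]

end LinearAlgebra

open Literature.Probability.Percolation Literature.Probability.LatticeModels
open Literature.Probability.LatticeModels.TemperleyLieb
open TriMarkedDomain

/-! ### The certificate criterion for boundary span -/

section Certificate

variable {m : ℕ}

/-- ★★★ **THE CENSUS-CERTIFICATE CRITERION FOR BOUNDARY NON-DEGENERACY** (home arc): if `z` assigns to every link pattern `Q` of `2m+2` sites a home-arc boundary mid-edge of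
some `(2m+1)`-marked domain, and the square matrix of boundary pattern counts `(lawLP (z Q)) Q′` has a unit determinant, then `BNonvanish (2m+1)` holds on the home arc — the
laws of these lawpoints already span the planar module. [cite: KhristoforovSmirnov2021, §2 eq. (4) and Remark 6 (arXiv v1 p. 5); PearceRittenbergDeGierNienhuis2002, §2] -/
theorem bNonvanish_of_isUnit_det_lawLP (z : LinkPattern (2 * m + 1 + 1) → Σ D : TriMarkedDomain (2 * m + 1), ArcPoint D (Fin.last (2 * m)))
    (hdet : IsUnit (Matrix.of fun Q Q' : LinkPattern (2 * m + 1 + 1) => lawLP (z Q).2 Q').det) :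
    BNonvanish (2 * m + 1) (Fin.last (2 * m)) := by
  classical
  have hspan : Submodule.span ℂ (Set.range fun Q => lawLP (z Q).2) = ⊤ :=
    span_eq_top_of_isUnit_det_apply (fun Q => lawLP (z Q).2) hdet
  rw [bNonvanish_last_iff_span_lawLP, ← top_le_iff, ← hspan]
  refine Submodule.span_mono ?_
  rintro _ ⟨Q, rfl⟩
  exact ⟨z Q, rfl⟩

/-- ★ the same with a NON-ZERO determinant (over `ℂ` a non-zero scalar is a unit). [cite: KhristoforovSmirnov2021, §2 eq. (4) and Remark 6 (arXiv v1 p. 5)] -/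
theorem bNonvanish_of_det_lawLP_ne_zero (z : LinkPattern (2 * m + 1 + 1) → Σ D : TriMarkedDomain (2 * m + 1), ArcPoint D (Fin.last (2 * m)))
    (hdet : (Matrix.of fun Q Q' : LinkPattern (2 * m + 1 + 1) => lawLP (z Q).2 Q').det ≠ 0) :
    BNonvanish (2 * m + 1) (Fin.last (2 * m)) :=
  bNonvanish_of_isUnit_det_lawLP z (isUnit_iff_ne_zero.2 hdet)

/-- ★★★ **… and boundary span on EVERY arc** (`k = 2m+3 ≥ 3`): a unit-determinant census certificate on the home arc gives `BSpan k a ∧ BNonvanish k a` for every arc `a`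
(arc independence, `bNonvanish_iff`). [cite: KhristoforovSmirnov2021, §1.2 (arXiv v1 p. 2: cyclic indexing); §2 eq. (4) (p. 5); BollobasRiordan2006, Ch. 7 §7.2.2 pp. 191–195] -/
theorem bSpan_of_isUnit_det_lawLP' {m : ℕ} (z : LinkPattern (2 * (m + 1) + 1 + 1) → Σ D : TriMarkedDomain (2 * (m + 1) + 1), ArcPoint D (Fin.last (2 * (m + 1))))
    (hdet : IsUnit (Matrix.of fun Q Q' : LinkPattern (2 * (m + 1) + 1 + 1) => lawLP (z Q).2 Q').det)
    (a : Fin (2 * (m + 1) + 1)) : BSpan (2 * (m + 1) + 1) a ∧ BNonvanish (2 * (m + 1) + 1) a := by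
  have h := bNonvanish_of_isUnit_det_lawLP z hdet
  have ha : BNonvanish (2 * (m + 1) + 1) a := (bNonvanish_iff (n := 2 * m + 1) a (Fin.last (2 * (m + 1)))).2 h
  exact ⟨(bSpan_iff_bNonvanish a).2 ha, ha⟩

/-- ★ the every-arc form with a non-zero determinant. [cite: KhristoforovSmirnov2021, §1.2 (arXiv v1 p. 2), §2 eq. (4) (p. 5)] -/
theorem bSpan_of_det_lawLP_ne_zero' {m : ℕ} (z : LinkPattern (2 * (m + 1) + 1 + 1) → Σ D : TriMarkedDomain (2 * (m + 1) + 1), ArcPoint D (Fin.last (2 * (m + 1))))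
    (hdet : (Matrix.of fun Q Q' : LinkPattern (2 * (m + 1) + 1 + 1) => lawLP (z Q).2 Q').det ≠ 0)
    (a : Fin (2 * (m + 1) + 1)) : BSpan (2 * (m + 1) + 1) a ∧ BNonvanish (2 * (m + 1) + 1) a :=
  bSpan_of_isUnit_det_lawLP' z (isUnit_iff_ne_zero.2 hdet) a

end Certificate

end Literature.Probability.Percolation.MarkedLoops
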